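import Literature.Geometry.Lorentzian.KerrConvergence

/-!
# Route StarvedNecks — crux `NecksCertify`, line `two-cap-focusing-ledger`: seam surgery, chart gluing

Helper file for the registered stub `stub_seamSurgery` (N2): the differential-topological GLUING of
the new hole chart of the seamed decomposition from the re-gauged chart `Ψ'` of the atlas
(pre-composed with a smooth push `θ` of the domain into the region where `Ψ'` is smooth) and the
flat chart pre-composed with the radial squash `G` of the far leaves, under the ONE-ATLAS agreement
`Ψ' = Φ` on the collar shell:

* `stub_seamSurgery_embedRestrict` (registered helper sub-goal; general form
  `isOpenEmbedding_restrict_comp_inclusion`) — open embeddings restrict along inclusions of open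
  subsets of `E4`;
* `exists_gluedChart` — the glued map is `C^∞` on the whole domain (two open pieces agreeing on
  their overlap), equals `Ψ'` resp. `Φ ∘ G` on the late region, is an open embedding of every late
  region (injective by the injectivity of `Ψ'` on the whole tube and of `Φ` on the flat-late
  region; open by the open-map property of both and of `G`), and maps into `O`.

Mathlib + `Literature.Geometry.Lorentzian.KerrConvergence`; no definitions, no named facts.
-/

noncomputable section

open scoped Manifold ContDiff Topology ENNReal
open Filter Set Function Topology Literature.Geometry.Lorentzian

namespace Summit.FinalStateConjecture.FinalStateConjecture.Theorems.NecksCertifyTwoCap.Seam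

set_option linter.dupNamespace false

section Embed

/-- Open embeddings restrict along inclusions of open subsets of `E4`: if `Φ : U₁ → X` is an open
embedding of an open `S₁ ⊆ U₁`, `U₂ ≤ U₁`, and the open `S₂ ⊆ U₂` is mapped into `S₁`, then
`Φ ∘ inclusion` is an open embedding of `S₂` (the induced map `S₂ → S₁` is an open embedding, being
sandwiched between the two open embeddings into `E4`). [folklore] -/
theorem isOpenEmbedding_restrict_comp_inclusion {X : Type*} [TopologicalSpace X]
    {U₁ U₂ : TopologicalSpace.Opens E4} (h : U₂ ≤ U₁) {S₁ : Set U₁} {S₂ : Set U₂}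
    (hS₁ : IsOpen S₁) (hS₂ : IsOpen S₂) (hmap : ∀ x, x ∈ S₂ → TopologicalSpace.Opens.inclusion h x ∈ S₁)
    {Φ : U₁ → X} (hΦ : IsOpenEmbedding (S₁.restrict Φ)) :
    IsOpenEmbedding (S₂.restrict (Φ ∘ TopologicalSpace.Opens.inclusion h)) := by
  let j : S₂ → S₁ := fun x ↦ ⟨TopologicalSpace.Opens.inclusion h x.1, hmap x.1 x.2⟩
  have hg₁ : IsOpenEmbedding (fun x : S₁ ↦ (x.1.1 : E4)) :=
    U₁.2.isOpenEmbedding_subtypeVal.comp hS₁.isOpenEmbedding_subtypeVal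
  have hg₂ : IsOpenEmbedding (fun x : S₂ ↦ (x.1.1 : E4)) :=
    U₂.2.isOpenEmbedding_subtypeVal.comp hS₂.isOpenEmbedding_subtypeVal
  have hj : IsOpenEmbedding j := IsOpenEmbedding.of_comp j hg₁ hg₂
  exact hΦ.comp hj

end Embed

/-- Registered helper sub-goal `stub_seamSurgery_embedRestrict` of N2: open embeddings of open
subsets restrict along inclusions of open subsets of `E4` (closed form of
`isOpenEmbedding_restrict_comp_inclusion` for spacetime-valued charts). [folklore] -/
theorem stub_seamSurgery_embedRestrict :
    ∀ (𝓢 : Spacetime.{0} 4) (U₁ U₂ : TopologicalSpace.Opens E4) (h : U₂ ≤ U₁) (S₁ : Set U₁)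
      (S₂ : Set U₂), IsOpen S₁ → IsOpen S₂ →
      (∀ x, x ∈ S₂ → TopologicalSpace.Opens.inclusion h x ∈ S₁) → ∀ (Φ : U₁ → 𝓢.carrier),
      IsOpenEmbedding (S₁.restrict Φ) →
      IsOpenEmbedding (S₂.restrict (Φ ∘ TopologicalSpace.Opens.inclusion h)) :=
  fun _ _ _ h _ _ hS₁ hS₂ hmap _ hΦ ↦ isOpenEmbedding_restrict_comp_inclusion h hS₁ hS₂ hmap hΦ

section Glue

variable {𝓢 : Spacetime 4}

/-- **Gluing the re-gauged hole chart with the squashed flat chart.**  Let `B` be a model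
background with continuous time `t` and radius `r`, `Ψ'` a chart on `B.domain` which is `C^∞` on
an open `U'` and an open embedding of `U'` into `O`, `Φ` a `C^∞` chart on an open `W₀ ⊆ E4`
which is an open embedding of its flat-late part `{τf < w⁰}` into `O`, `θ` a smooth push of the
domain into `{t > τ₁ + 1 + s}` (identity on `{t ≥ τ₁ + 2 + s}`, radius-preserving), `G` the radial
squash onto the shell `[b(t), b(t) + 1/2)` (lab frame; `exists_labSquash`), and assume ONE ATLAS:
`Ψ' = Φ` at the flat-late points of `{t > τ₁ + 1 + s, b(t) − 1/5 < r < b(t) + 1/2}`.  Then the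
glued map — `Ψ' ∘ θ` on `{r < b(t∘θ)}`, `Φ ∘ G ∘ θ` beyond — is `C^∞` on the whole domain, equals
`Ψ'` resp. `Φ ∘ G` on the late region, is an open embedding of every late region
`{t > Tl}`, `Tl ≥ τ₁ + 2 + s`, and maps into `O`.  DHRT arXiv:2104.08222, §1 (late charts).
[folklore] -/
theorem exists_gluedChart (O : Set 𝓢.carrier) (B : ModelBackground)
    (hTc : Continuous B.time) (hRc : Continuous B.radius)
    (r₀ τ₁ s τf : ℝ) (hr₀ : 0 < r₀) (b : ℝ → ℝ) (hbc : Continuous b) (hbr : ∀ t, r₀ < b t - 1 / 5)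
    (hdom : ∀ y : E4, r₀ < B.radius y → y ∈ B.domain)
    (θ : E4 → E4) (hθ1 : ContDiff ℝ ∞ θ) (hθ2 : ∀ y, B.radius (θ y) = B.radius y)
    (hθ3 : ∀ y, τ₁ + 1 + s < B.time (θ y)) (hθ4 : ∀ y, τ₁ + 2 + s ≤ B.time y → θ y = y)
    (hθ5 : ∀ y, y ∈ B.domain → θ y ∈ B.domain)
    (σ : ℝ → ℝ → ℝ) (G : E4 → E4) (hσ1 : ∀ t ρ, ρ ≤ b t → σ t ρ = ρ)
    (hσ3 : ∀ t ρ, σ t ρ < b t + 1 / 2) (hσ4 : ∀ t ρ, b t ≤ ρ → b t ≤ σ t ρ)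
    (hG1 : ∀ y, B.time (G y) = B.time y)
    (hG2 : ∀ y, 0 < B.radius y → B.radius (G y) = σ (B.time y) (B.radius y))
    (hG3 : ∀ y, 0 < B.radius y → B.radius y ≤ b (B.time y) → G y = y)
    (hG4 : ContDiffOn ℝ ∞ G {y | 0 < B.radius y}) (hG5 : InjOn G {y | 0 < B.radius y})
    (hG6 : ∀ V : Set E4, IsOpen V → V ⊆ {y | r₀ < B.radius y} → IsOpen (G '' V))
    (Ψ' : B.domain → 𝓢.carrier) (U' : Set B.domain)
    (hΨ'1 : ContMDiffOn 𝓘(ℝ, E4) (𝓡 4) ∞ Ψ' U') (hΨ'2 : IsOpenEmbedding (U'.restrict Ψ'))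
    (hΨ'3 : Ψ' '' U' ⊆ O)
    (hU'1 : ∀ y : B.domain, τ₁ + 1 + s < B.time y → B.radius y < b (B.time y) + 1 / 2 → y ∈ U')
    (W₀ : TopologicalSpace.Opens E4) (Φ : W₀ → 𝓢.carrier) (hΦ1 : ContMDiff 𝓘(ℝ, E4) (𝓡 4) ∞ Φ)
    (hΦ2 : IsOpenEmbedding (Set.restrict {w : W₀ | τf < w.1 0} Φ))
    (hΦ3 : ∀ w : W₀, τf < w.1 0 → Φ w ∈ O) (w₀ : W₀)
    (hagree : ∀ y : B.domain, τ₁ + 1 + s < B.time y → b (B.time y) - 1 / 5 < B.radius y →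
      B.radius y < b (B.time y) + 1 / 2 →
      ∃ hw : (y : E4) ∈ W₀, Ψ' y = Φ ⟨y, hw⟩ ∧ τf < (y : E4) 0) :
    ∃ Gl : B.domain → 𝓢.carrier,
      ContMDiff 𝓘(ℝ, E4) (𝓡 4) ∞ Gl ∧
      (∀ x : B.domain, τ₁ + 2 + s ≤ B.time x → B.radius x < b (B.time x) → Gl x = Ψ' x) ∧
      (∀ x : B.domain, τ₁ + 2 + s ≤ B.time x → b (B.time x) ≤ B.radius x →
        ∃ hw : G x ∈ W₀, Gl x = Φ ⟨G x, hw⟩ ∧ τf < G x 0) ∧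
      (∀ Tl, τ₁ + 2 + s ≤ Tl →
        IsOpenEmbedding (Set.restrict {x : B.domain | Tl < B.time x} Gl)) ∧
      (∀ x, Gl x ∈ O) := by
  -- the push as a self-map of the domain
  set θ' : B.domain → B.domain := fun x ↦ ⟨θ x, hθ5 x x.2⟩ with hθ'
  have hθ'c : ContMDiff 𝓘(ℝ, E4) 𝓘(ℝ, E4) ∞ θ' :=
    (ContMDiff.subtypeVal_comp_iff _ _).1 ((contMDiff_iff_contDiff.mpr hθ1).comp contMDiff_subtype_val)
  -- the two open regions
  set V₁ : Set B.domain := {x | B.radius x < b (B.time (θ x))} with hV₁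
  set V₂ : Set B.domain := {x | b (B.time (θ x)) - 1 / 5 < B.radius x} with hV₂
  have hcont : Continuous fun x : B.domain ↦ b (B.time (θ x)) :=
    hbc.comp (hTc.comp (hθ1.continuous.comp continuous_subtype_val))
  have hV₁o : IsOpen V₁ := isOpen_lt (hRc.comp continuous_subtype_val) hcont
  have hV₂o : IsOpen V₂ := isOpen_lt (hcont.sub continuous_const) (hRc.comp continuous_subtype_val)
  have hcover : ∀ x, x ∈ V₁ ∨ x ∈ V₂ := fun x ↦ by
    rcases lt_or_ge (B.radius x.1) (b (B.time (θ x))) with h | h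
    · exact Or.inl h
    · right; show b (B.time (θ x)) - 1 / 5 < B.radius x.1; linarith
  have hV₂pos : ∀ x ∈ V₂, 0 < B.radius (θ x) := fun x hx ↦ by
    rw [hθ2]; have : b (B.time (θ x)) - 1 / 5 < B.radius x.1 := hx; linarith [hbr (B.time (θ x))]
  -- formula 1 region lands in `U'`
  have hV₁U' : ∀ x ∈ V₁, θ' x ∈ U' := fun x hx ↦
    hU'1 _ (hθ3 x) (by
      show B.radius (θ x) < b (B.time (θ x)) + 1 / 2
      rw [hθ2]; have : B.radius x.1 < b (B.time (θ x)) := hx; linarith)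
  -- formula 2 region: the squashed point is in the one-atlas collar
  have hGθ : ∀ x ∈ V₂, b (B.time (G (θ x))) - 1 / 5 < B.radius (G (θ x)) ∧
      B.radius (G (θ x)) < b (B.time (G (θ x))) + 1 / 2 ∧ τ₁ + 1 + s < B.time (G (θ x)) ∧
      r₀ < B.radius (G (θ x)) := by
    intro x hx
    have hx' : b (B.time (θ x)) - 1 / 5 < B.radius x.1 := hx
    have hpos := hV₂pos x hx
    rw [hG1, hG2 _ hpos, hθ2]
    refine ⟨?_, hσ3 _ _, hθ3 x, ?_⟩
    · rcases le_or_gt (B.radius x.1) (b (B.time (θ x))) with h | h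
      · rw [hσ1 _ _ h]; exact hx'
      · linarith [hσ4 _ _ h.le]
    · rcases le_or_gt (B.radius x.1) (b (B.time (θ x))) with h | h
      · rw [hσ1 _ _ h]; linarith [hbr (B.time (θ x))]
      · linarith [hσ4 _ _ h.le, hbr (B.time (θ x))]
  have hGθW : ∀ x (hx : x ∈ V₂), ∃ hw : G (θ x) ∈ W₀,
      Ψ' ⟨G (θ x), hdom _ (hGθ x hx).2.2.2⟩ = Φ ⟨G (θ x), hw⟩ ∧ τf < G (θ x) 0 := fun x hx ↦
    hagree ⟨G (θ x), hdom _ (hGθ x hx).2.2.2⟩ (hGθ x hx).2.2.1 (hGθ x hx).1 (hGθ x hx).2.1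
  -- the two formulas and the glued map
  classical
  set j : B.domain → W₀ := fun x ↦ if h : G (θ x) ∈ W₀ then ⟨G (θ x), h⟩ else w₀ with hj
  have hjV₂ : ∀ x (hx : x ∈ V₂), j x = ⟨G (θ x), (hGθW x hx).fst⟩ := fun x hx ↦
    dif_pos (hGθW x hx).fst
  set F₁ : B.domain → 𝓢.carrier := fun x ↦ Ψ' (θ' x) with hF₁
  set F₂ : B.domain → 𝓢.carrier := fun x ↦ Φ (j x) with hF₂
  set Gl : B.domain → 𝓢.carrier := fun x ↦ if x ∈ V₁ then F₁ x else F₂ x with hGl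
  have hGl1 : ∀ x ∈ V₁, Gl x = F₁ x := fun x hx ↦ if_pos hx
  have hF12 : ∀ x ∈ V₁, x ∈ V₂ → F₁ x = F₂ x := by
    intro x h1 h2
    have hx1 : B.radius x.1 < b (B.time (θ x)) := h1
    have hx2 : b (B.time (θ x)) - 1 / 5 < B.radius x.1 := h2
    have hpos := hV₂pos x h2
    have hGid : G (θ x) = θ x := hG3 _ hpos (by rw [hθ2]; exact hx1.le)
    obtain ⟨hw, heq, -⟩ := hagree (θ' x) (hθ3 x) (by show _ < B.radius (θ x); rw [hθ2]; exact hx2)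
      (by show B.radius (θ x) < _; rw [hθ2]; linarith)
    have hjx : j x = ⟨θ x, hw⟩ := by
      rw [hjV₂ x h2]; exact Subtype.ext hGid
    simp only [hF₁, hF₂, hjx]
    exact heq
  have hGl2 : ∀ x ∈ V₂, Gl x = F₂ x := fun x hx ↦ by
    by_cases h : x ∈ V₁
    · rw [hGl1 x h, hF12 x h hx]
    · exact if_neg h
  -- smoothness of the two formulas
  have hF₁s : ContMDiffOn 𝓘(ℝ, E4) (𝓡 4) ∞ F₁ V₁ :=
    hΨ'1.comp hθ'c.contMDiffOn fun x hx ↦ hV₁U' x hx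
  have hGθs : ContDiffOn ℝ ∞ (G ∘ θ) {y : E4 | 0 < B.radius (θ y)} :=
    hG4.comp hθ1.contDiffOn fun y hy ↦ hy
  have hjs : ContMDiffOn 𝓘(ℝ, E4) 𝓘(ℝ, E4) ∞ j V₂ := by
    intro x hx
    rw [← ContMDiffWithinAt.subtypeVal_comp_iff]
    have h1 : ContMDiffOn 𝓘(ℝ, E4) 𝓘(ℝ, E4) ∞ (fun x : B.domain ↦ G (θ x)) V₂ :=
      (contMDiffOn_iff_contDiffOn.mpr hGθs).comp contMDiff_subtype_val.contMDiffOn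
        fun x hx ↦ hV₂pos x hx
    refine (h1 x hx).congr (fun y hy ↦ ?_) ?_
    · show (j y : E4) = G (θ y); rw [hjV₂ y hy]
    · show (j x : E4) = G (θ x); rw [hjV₂ x hx]
  have hF₂s : ContMDiffOn 𝓘(ℝ, E4) (𝓡 4) ∞ F₂ V₂ := hΦ1.comp_contMDiffOn hjs
  have hGls : ContMDiff 𝓘(ℝ, E4) (𝓡 4) ∞ Gl := by
    intro x
    rcases hcover x with hx | hx
    · refine ((hF₁s x hx).contMDiffAt (hV₁o.mem_nhds hx)).congr_of_eventuallyEq ?_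
      filter_upwards [hV₁o.mem_nhds hx] with y hy using hGl1 y hy
    · refine ((hF₂s x hx).contMDiffAt (hV₂o.mem_nhds hx)).congr_of_eventuallyEq ?_
      filter_upwards [hV₂o.mem_nhds hx] with y hy using hGl2 y hy
  -- late points: the push is the identity
  have hlate1 : ∀ x : B.domain, τ₁ + 2 + s ≤ B.time x → θ x = x := fun x hx ↦ hθ4 x hx
  have hlateθ' : ∀ x : B.domain, τ₁ + 2 + s ≤ B.time x → θ' x = x := fun x hx ↦
    Subtype.ext (hlate1 x hx)
  have hc2 : ∀ x : B.domain, τ₁ + 2 + s ≤ B.time x → B.radius x < b (B.time x) → Gl x = Ψ' x := by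
    intro x hx hr
    have h1 : x ∈ V₁ := by show B.radius x.1 < b (B.time (θ x)); rwa [hlate1 x hx]
    rw [hGl1 x h1]
    simp only [hF₁, hlateθ' x hx]
  have hc3 : ∀ x : B.domain, τ₁ + 2 + s ≤ B.time x → b (B.time x) ≤ B.radius x →
      ∃ hw : G x ∈ W₀, Gl x = Φ ⟨G x, hw⟩ ∧ τf < G x 0 := by
    intro x hx hr
    have h2 : x ∈ V₂ := by show b (B.time (θ x)) - 1 / 5 < B.radius x.1; rw [hlate1 x hx]; linarith
    obtain ⟨hw, -, hlate⟩ := hGθW x h2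
    rw [hlate1 x hx] at hw hlate
    refine ⟨hw, ?_, hlate⟩
    rw [hGl2 x h2]
    simp only [hF₂, hjV₂ x h2]
    congr 1
    exact Subtype.ext (by simp [hlate1 x hx])
  have hc5 : ∀ x, Gl x ∈ O := by
    intro x
    rcases hcover x with hx | hx
    · rw [hGl1 x hx]; exact hΨ'3 ⟨θ' x, hV₁U' x hx, rfl⟩
    · rw [hGl2 x hx]
      simp only [hF₂, hjV₂ x hx]
      exact hΦ3 _ (hGθW x hx).snd.2
  refine ⟨Gl, hGls, hc2, hc3, fun Tl hTl ↦ ?_, hc5⟩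
  -- the open embedding of the late region `{Tl < t}`
  set L : Set B.domain := {x | Tl < B.time x} with hL
  have hLo : IsOpen L := isOpen_lt continuous_const (hTc.comp continuous_subtype_val)
  have hLlate : ∀ x ∈ L, τ₁ + 2 + s ≤ B.time x := fun x hx ↦ hTl.trans (le_of_lt hx)
  have hΨinj : ∀ y₁ ∈ U', ∀ y₂ ∈ U', Ψ' y₁ = Ψ' y₂ → y₁ = y₂ := fun y₁ h₁ y₂ h₂ h ↦
    congrArg Subtype.val (hΨ'2.injective (a₁ := ⟨y₁, h₁⟩) (a₂ := ⟨y₂, h₂⟩) h)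
  have hΦinj : ∀ w₁ w₂ : W₀, τf < w₁.1 0 → τf < w₂.1 0 → Φ w₁ = Φ w₂ → w₁ = w₂ :=
    fun w₁ w₂ h₁ h₂ h ↦ congrArg Subtype.val (hΦ2.injective (a₁ := ⟨w₁, h₁⟩) (a₂ := ⟨w₂, h₂⟩) h)
  have hsmallU' : ∀ x ∈ L, B.radius x < b (B.time x) → x ∈ U' := fun x hx hr ↦
    hU'1 x (by linarith [hLlate x hx]) (by linarith)
  have hbig : ∀ x ∈ L, b (B.time x) ≤ B.radius x → 0 < B.radius x.1 ∧
      b (B.time x) ≤ B.radius (G x) ∧ B.radius (G x) < b (B.time x) + 1 / 2 ∧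
      B.time (G x) = B.time x ∧ r₀ < B.radius (G x) := by
    intro x hx hr
    have h0 : 0 < B.radius x.1 := by linarith [hbr (B.time x.1)]
    rw [hG1, hG2 _ h0]
    exact ⟨h0, hσ4 _ _ hr, hσ3 _ _, rfl, by linarith [hσ4 _ _ hr, hbr (B.time x.1)]⟩
  have hbigU' : ∀ x (hx : x ∈ L) (hr : b (B.time x) ≤ B.radius x),
      (⟨G x, hdom _ (hbig x hx hr).2.2.2.2⟩ : B.domain) ∈ U' := fun x hx hr ↦
    hU'1 _ (by show τ₁ + 1 + s < B.time (G x); rw [hG1]; linarith [hLlate x hx])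
      (by show B.radius (G x) < b (B.time (G x)) + 1 / 2; rw [hG1]; exact (hbig x hx hr).2.2.1)
  -- unified formula on the collar and beyond
  have hc3' : ∀ x ∈ L, b (B.time x) - 1 / 5 < B.radius x →
      ∃ hw : G x ∈ W₀, Gl x = Φ ⟨G x, hw⟩ ∧ τf < G x 0 := by
    intro x hx hr
    rcases lt_or_ge (B.radius x.1) (b (B.time x)) with h | h
    · have h0 : 0 < B.radius x.1 := by linarith [hbr (B.time x.1)]
      have hGx : G x = x := hG3 _ h0 h.le
      obtain ⟨hw, heq, hl⟩ := hagree x (by linarith [hLlate x hx]) hr (by linarith)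
      refine ⟨by rw [hGx]; exact hw, ?_, by rw [hGx]; exact hl⟩
      rw [hc2 x (hLlate x hx) h, heq]
      congr 1
      exact Subtype.ext hGx.symm
    · exact hc3 x (hLlate x hx) h
  refine IsOpenEmbedding.of_continuous_injective_isOpenMap
    (hGls.continuous.comp continuous_subtype_val) ?_ ?_
  · -- injectivity on the late region
    rintro ⟨x₁, h₁⟩ ⟨x₂, h₂⟩ h
    change Gl x₁ = Gl x₂ at h
    rw [Subtype.mk.injEq]
    rcases lt_or_ge (B.radius x₁.1) (b (B.time x₁)) with r₁ | r₁ <;>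
      rcases lt_or_ge (B.radius x₂.1) (b (B.time x₂)) with r₂ | r₂
    · rw [hc2 x₁ (hLlate x₁ h₁) r₁, hc2 x₂ (hLlate x₂ h₂) r₂] at h
      exact hΨinj _ (hsmallU' x₁ h₁ r₁) _ (hsmallU' x₂ h₂ r₂) h
    · exfalso
      obtain ⟨hw, h2, -⟩ := hc3 x₂ (hLlate x₂ h₂) r₂
      obtain ⟨hw', heq, -⟩ := hagree ⟨G x₂, hdom _ (hbig x₂ h₂ r₂).2.2.2.2⟩
        (by show τ₁ + 1 + s < B.time (G x₂); rw [hG1]; linarith [hLlate x₂ h₂])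
        (by show _ < B.radius (G x₂); rw [hG1]; linarith [(hbig x₂ h₂ r₂).2.1])
        (by show B.radius (G x₂) < _; rw [hG1]; exact (hbig x₂ h₂ r₂).2.2.1)
      rw [hc2 x₁ (hLlate x₁ h₁) r₁, h2] at h
      have h' : Ψ' x₁ = Ψ' ⟨G x₂, hdom _ (hbig x₂ h₂ r₂).2.2.2.2⟩ := h.trans heq.symm
      have e := hΨinj _ (hsmallU' x₁ h₁ r₁) _ (hbigU' x₂ h₂ r₂) h'
      have e1 : B.radius x₁.1 = B.radius (G x₂) := congrArg (fun y : B.domain ↦ B.radius y.1) e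
      have e2 : B.time x₁.1 = B.time (G x₂) := congrArg (fun y : B.domain ↦ B.time y.1) e
      rw [hG1] at e2
      rw [e2] at r₁
      linarith [(hbig x₂ h₂ r₂).2.1]
    · exfalso
      obtain ⟨hw, h1, -⟩ := hc3 x₁ (hLlate x₁ h₁) r₁
      obtain ⟨hw', heq, -⟩ := hagree ⟨G x₁, hdom _ (hbig x₁ h₁ r₁).2.2.2.2⟩
        (by show τ₁ + 1 + s < B.time (G x₁); rw [hG1]; linarith [hLlate x₁ h₁])
        (by show _ < B.radius (G x₁); rw [hG1]; linarith [(hbig x₁ h₁ r₁).2.1])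
        (by show B.radius (G x₁) < _; rw [hG1]; exact (hbig x₁ h₁ r₁).2.2.1)
      rw [hc2 x₂ (hLlate x₂ h₂) r₂, h1] at h
      have h' : Ψ' x₂ = Ψ' ⟨G x₁, hdom _ (hbig x₁ h₁ r₁).2.2.2.2⟩ := h.symm.trans heq.symm
      have e := hΨinj _ (hsmallU' x₂ h₂ r₂) _ (hbigU' x₁ h₁ r₁) h'
      have e1 : B.radius x₂.1 = B.radius (G x₁) := congrArg (fun y : B.domain ↦ B.radius y.1) e
      have e2 : B.time x₂.1 = B.time (G x₁) := congrArg (fun y : B.domain ↦ B.time y.1) e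
      rw [hG1] at e2
      rw [e2] at r₂
      linarith [(hbig x₁ h₁ r₁).2.1]
    · obtain ⟨hw₁, e₁, l₁⟩ := hc3 x₁ (hLlate x₁ h₁) r₁
      obtain ⟨hw₂, e₂, l₂⟩ := hc3 x₂ (hLlate x₂ h₂) r₂
      rw [e₁, e₂] at h
      have hG : G x₁ = G x₂ := congrArg Subtype.val (hΦinj _ _ l₁ l₂ h)
      exact Subtype.ext (hG5 (hbig x₁ h₁ r₁).1 (hbig x₂ h₂ r₂).1 hG)
  · -- open map on the late region
    intro O' hO'
    set S : Set B.domain := Subtype.val '' O' with hS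
    have hSo : IsOpen S := hLo.isOpenMap_subtype_val O' hO'
    have hSL : S ⊆ L := by rintro _ ⟨z, _, rfl⟩; exact z.2
    set S₁ : Set B.domain := S ∩ {x | B.radius x < b (B.time x)} with hS₁
    set S₂ : Set B.domain := S ∩ {x | b (B.time x) - 1 / 5 < B.radius x} with hS₂
    have hcb : Continuous fun x : B.domain ↦ b (B.time x) :=
      hbc.comp (hTc.comp continuous_subtype_val)
    have hS₁o : IsOpen S₁ := hSo.inter (isOpen_lt (hRc.comp continuous_subtype_val) hcb)
    have hS₂o : IsOpen S₂ :=
      hSo.inter (isOpen_lt (hcb.sub continuous_const) (hRc.comp continuous_subtype_val))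
    have himage : L.restrict Gl '' O' = Gl '' S₁ ∪ Gl '' S₂ := by
      ext z
      constructor
      · rintro ⟨w, hw, rfl⟩
        have hwS : (w : B.domain) ∈ S := ⟨w, hw, rfl⟩
        rcases lt_or_ge (B.radius (w : B.domain).1) (b (B.time (w : B.domain))) with h | h
        · exact Or.inl ⟨w, ⟨hwS, h⟩, rfl⟩
        · exact Or.inr ⟨w, ⟨hwS, show b (B.time (w : B.domain).1) - 1 / 5 < B.radius (w : B.domain).1 by
            linarith⟩, rfl⟩
      · rintro (⟨x, ⟨⟨w, hw, rfl⟩, -⟩, rfl⟩ | ⟨x, ⟨⟨w, hw, rfl⟩, -⟩, rfl⟩) <;> exact ⟨w, hw, rfl⟩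
    rw [himage]
    refine IsOpen.union ?_ ?_
    · have hS₁U' : S₁ ⊆ U' := fun x hx ↦ hsmallU' x (hSL hx.1) hx.2
      have heq : Gl '' S₁ = U'.restrict Ψ' '' (Subtype.val ⁻¹' S₁) := by
        ext z
        constructor
        · rintro ⟨x, hx, rfl⟩
          exact ⟨⟨x, hS₁U' hx⟩, hx, (hc2 x (hLlate x (hSL hx.1)) hx.2).symm⟩
        · rintro ⟨⟨x, hxU⟩, hx, rfl⟩
          exact ⟨x, hx, hc2 x (hLlate x (hSL hx.1)) hx.2⟩
      rw [heq]
      exact hΨ'2.isOpenMap _ (hS₁o.preimage continuous_subtype_val)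
    · set E₂ : Set E4 := G '' (Subtype.val '' S₂) with hE₂
      have hE₂o : IsOpen E₂ := hG6 _ (B.domain.isOpen.isOpenMap_subtype_val _ hS₂o) (by
        rintro _ ⟨x, hx, rfl⟩
        have h2 : b (B.time x.1) - 1 / 5 < B.radius x.1 := hx.2
        show r₀ < B.radius x.1
        linarith [hbr (B.time x.1)])
      set P₂ : Set {w : W₀ | τf < w.1 0} := {w | ((w : W₀) : E4) ∈ E₂} with hP₂
      have hP₂o : IsOpen P₂ := hE₂o.preimage (continuous_subtype_val.comp continuous_subtype_val)
      have heq : Gl '' S₂ = Set.restrict {w : W₀ | τf < w.1 0} Φ '' P₂ := by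
        ext z
        constructor
        · rintro ⟨x, hx, rfl⟩
          obtain ⟨hw, e, l⟩ := hc3' x (hSL hx.1) hx.2
          exact ⟨⟨⟨G x, hw⟩, l⟩, ⟨x, ⟨x, hx, rfl⟩, rfl⟩, e.symm⟩
        · rintro ⟨⟨⟨w, hwW⟩, hwl⟩, ⟨_, ⟨x, hx, rfl⟩, hy⟩, rfl⟩
          obtain ⟨hw, e, l⟩ := hc3' x (hSL hx.1) hx.2
          refine ⟨x, hx, ?_⟩
          rw [e]
          show Φ _ = Φ _
          congr 1
          exact Subtype.ext hy
      rw [heq]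
      exact hΦ2.isOpenMap _ hP₂o

end Glue

end Summit.FinalStateConjecture.FinalStateConjecture.Theorems.NecksCertifyTwoCap.Seam

end
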